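import Summits.HubbardSuperconductivity.HubbardSuperconductivity.Theorems.NodalWardXYNodalReductionDefs

/-!
# Good ground vector: crux `NodalReduction` (stmt-HubbardSuperconductivity-1268), line `Sketch`, stub `stub_goodGroundVector`

The finite-dimensional linear-algebra fact `GoodGroundVector` (statement (E) of
`NodalWardXYNodalReductionDefs`): for commuting Hermitian `K, N : Matrix n n ℂ` and any `A`, if
`t ≤ Re ω_K(A)` for the tracial ground-state functional `ω_K(A) = (tr P)⁻¹ tr (P A)`,
`P = K.groundProj`, then some unit joint eigenvector `Φ` (`K Φ = E₀ Φ`, `N Φ = c Φ`) has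
`t ≤ Re ⟨Φ, A Φ⟩` ("maximum ≥ average over an `N`-adapted orthonormal basis of the ground space").

Design (no orthonormal bases of subspaces, no operator norms). Put
`B := N - E₀(N) + 1` (so `B - 1 ≥ 0`, `Matrix.posSemidef_sub_groundEnergy`) and consider the auxiliary
Hermitian matrix `M := P B P`; `P` commutes with `N` (`Matrix.groundProj_commute_of_commute`), hence
with `B`. Let `(v_j)` be Mathlib's orthonormal eigenbasis of `M` (`Matrix.IsHermitian.eigenvectorBasis`),
packaged as a family of vectors with `tr X = Σ_j ⟨v_j, X v_j⟩` (trace in the columns of the eigenvector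
unitary, `ggv_trace_eq_sum`). DICHOTOMY (`ggv_dichotomy`): an eigenvector `v` of `M` with eigenvalue
`c ≠ 0` lies in the range of `P` (`v = c⁻¹ M v = P(…)`), while `c = 0` forces
`0 = ⟨v, M v⟩ = ⟨P v, (B - 1) P v⟩ + ‖P v‖² ≥ ‖P v‖²`, i.e. `P v = 0`. Consequently
`tr P = #J` and `tr (P A) = Σ_{j ∈ J} ⟨v_j, A v_j⟩` for `J = {j | P v_j = v_j}` (`ggv_exists_good_index`),
so `Re ω_K(A)` is the average of `Re ⟨v_j, A v_j⟩` over `J ≠ ∅` (`tr P ≠ 0`) and some `j ∈ J` beats the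
average (`Finset.exists_le_of_sum_le`). For such `j`: `P v_j = v_j` gives `K v_j = E₀ v_j`
(`Matrix.groundProj_mulVec_mem`), and `B v_j = P B P v_j = M v_j = c v_j` gives
`N v_j = (c - 1 + E₀(N)) v_j`. The hypothesis `A.PosSemidef` of the registered statement is not needed.

Sources: T. Koma, H. Tasaki, J. Stat. Phys. 76 (1994) 745, proof of Theorem 2.2 (choice of the ground
state in a fixed particle-number sector); H. Tasaki, *Physics and Mathematics of Quantum Many-Body
Systems* (2020), §2.1. Tree facts used: the `Matrix.groundProj` API of
`Literature.MathematicalPhysics.QuantumLattice.FinDimSpectrumProofs`; Mathlib's spectral theorem for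
Hermitian matrices (`Matrix.IsHermitian.eigenvectorBasis`, `eigenvectorUnitary`).
-/

noncomputable section

-- `Summit.HubbardSuperconductivity.HubbardSuperconductivity.…` is the tree's summit/sub-problem namespace (D-0017).
set_option linter.dupNamespace false

namespace Summit.HubbardSuperconductivity.HubbardSuperconductivity.Theorems.NodalReduction

open Matrix Literature.MathematicalPhysics.QuantumLattice
open scoped ComplexOrder

variable {m : Type*} [Fintype m]

/-! ### Trace in an orthonormal family; moving a Hermitian matrix across the pairing -/

/-- Trace in the columns of a matrix `U` with `U U⋆ = 1`:  `tr X = Σ_j ⟨u_j, X u_j⟩`, `u_j = Uᵀ j` the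
`j`-th column (`tr X = tr (U⋆ X U)` and the diagonal entries of `U⋆ X U`). -/
theorem ggv_trace_eq_sum [DecidableEq m] (U X : Matrix m m ℂ) (hU : U * star U = 1) :
    X.trace = ∑ j, star (Uᵀ j) ⬝ᵥ (X *ᵥ Uᵀ j) := by
  calc X.trace = (X * (U * star U)).trace := by rw [hU, Matrix.mul_one]
    _ = (star U * (X * U)).trace := by rw [← Matrix.mul_assoc, trace_mul_comm]
    _ = ∑ j, star (Uᵀ j) ⬝ᵥ (X *ᵥ Uᵀ j) := by
        simp only [trace, diag_apply, mul_apply, star_apply, dotProduct, mulVec, transpose_apply,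
          Pi.star_apply]

/-- The orthonormal eigenbasis of a Hermitian matrix as a plain family of vectors: unit vectors,
eigenvectors, and the trace of every matrix is the sum of its diagonal matrix elements in the family. -/
theorem ggv_exists_eigenfamily [DecidableEq m] {M : Matrix m m ℂ} (hM : M.IsHermitian) :
    ∃ v : m → m → ℂ, (∀ j, star (v j) ⬝ᵥ v j = 1) ∧ (∀ j, ∃ c : ℂ, M *ᵥ v j = c • v j) ∧
      ∀ X : Matrix m m ℂ, X.trace = ∑ j, star (v j) ⬝ᵥ (X *ᵥ v j) := by
  refine ⟨fun j => ⇑(hM.eigenvectorBasis j), fun j => ?_,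
    fun j => ⟨((hM.eigenvalues j : ℝ) : ℂ), ?_⟩, fun X => ?_⟩
  · rw [dotProduct_comm]
    exact hM.eigenvectorBasis.inner_eq_one j
  · -- `M b_j = λ_j b_j`, with the real eigenvalue coerced to `ℂ`
    have h := hM.mulVec_eigenvectorBasis j
    rw [RCLike.real_smul_eq_coe_smul (K := ℂ)] at h
    exact h
  · rw [ggv_trace_eq_sum _ X (Matrix.mem_unitaryGroup_iff.1 hM.eigenvectorUnitary.2)]
    simp only [Matrix.IsHermitian.eigenvectorUnitary_transpose_apply]

/-- Moving a Hermitian matrix across the pairing: `⟨P v, w⟩ = ⟨v, P w⟩`. -/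
theorem ggv_adj {P : Matrix m m ℂ} (hP : P.IsHermitian) (v w : m → ℂ) :
    star (P *ᵥ v) ⬝ᵥ w = star v ⬝ᵥ (P *ᵥ w) := by
  rw [star_mulVec, hP.eq, ← dotProduct_mulVec]

/-- Compression by a Hermitian matrix: `⟨v, (P X P) v⟩ = ⟨P v, X (P v)⟩`. -/
theorem ggv_sandwich {P : Matrix m m ℂ} (hP : P.IsHermitian) (X : Matrix m m ℂ) (v : m → ℂ) :
    star v ⬝ᵥ ((P * X * P) *ᵥ v) = star (P *ᵥ v) ⬝ᵥ (X *ᵥ (P *ᵥ v)) := by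
  rw [ggv_adj hP, mulVec_mulVec, mulVec_mulVec]

/-! ### The dichotomy for eigenvectors of `P B P` -/

/-- **Dichotomy.** For a Hermitian idempotent `P` and a matrix `B` with `B - 1 ≥ 0` (as a quadratic
form), every eigenvector `v` of `P B P` is either fixed or killed by `P`: if the eigenvalue `c` is
non-zero then `v = c⁻¹ (P B P) v` lies in the range of `P`; if `c = 0` then
`0 = ⟨v, P B P v⟩ = ⟨P v, (B - 1) P v⟩ + ‖P v‖² ≥ ‖P v‖²`. -/
theorem ggv_dichotomy [DecidableEq m] {P B : Matrix m m ℂ} (hPh : P.IsHermitian) (hPP : P * P = P)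
    (hB : ∀ w : m → ℂ, 0 ≤ star w ⬝ᵥ ((B - 1) *ᵥ w)) {v : m → ℂ} {c : ℂ}
    (hv : (P * B * P) *ᵥ v = c • v) : P *ᵥ v = v ∨ P *ᵥ v = 0 := by
  by_cases hc : c = 0
  · right
    subst hc
    have h0 : star (P *ᵥ v) ⬝ᵥ (B *ᵥ (P *ᵥ v)) = 0 := by
      rw [← ggv_sandwich hPh B v, hv, zero_smul, dotProduct_zero]
    have hsplit : star (P *ᵥ v) ⬝ᵥ (B *ᵥ (P *ᵥ v)) =
        star (P *ᵥ v) ⬝ᵥ ((B - 1) *ᵥ (P *ᵥ v)) + star (P *ᵥ v) ⬝ᵥ (P *ᵥ v) := by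
      rw [sub_mulVec, one_mulVec, dotProduct_sub, sub_add_cancel]
    rw [hsplit] at h0
    exact dotProduct_star_self_eq_zero.1
      ((add_eq_zero_iff_of_nonneg (hB _) (dotProduct_star_self_nonneg _)).1 h0).2
  · left
    have hPM : P * (P * B * P) = P * B * P := by rw [← mul_assoc, ← mul_assoc, hPP]
    calc P *ᵥ v = c⁻¹ • (P *ᵥ (c • v)) := by
          rw [mulVec_smul, smul_smul, inv_mul_cancel₀ hc, one_smul]
      _ = v := by rw [← hv, mulVec_mulVec, hPM, hv, smul_smul, inv_mul_cancel₀ hc, one_smul]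

/-! ### Averaging: some good index beats the tracial average -/

/-- **Max ≥ average.** Let `P` be Hermitian with `tr P ≠ 0`, and `(v_j)` a family of unit vectors, each
fixed or killed by `P`, in which traces are computed (`tr X = Σ_j ⟨v_j, X v_j⟩`). Then
`tr P = #J`, `tr (P A) = Σ_{j ∈ J} ⟨v_j, A v_j⟩` for `J = {j | P v_j = v_j}`, so
`Re ((tr P)⁻¹ tr (P A))` is the average of `Re ⟨v_j, A v_j⟩` over the nonempty `J`, and some `j ∈ J`
has `Re ⟨v_j, A v_j⟩ ≥ t` whenever the average is `≥ t`. -/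
theorem ggv_exists_good_index {ι : Type*} [Fintype ι] {P A : Matrix m m ℂ} (hPh : P.IsHermitian)
    (hP0 : P.trace ≠ 0) {v : ι → m → ℂ} (hv1 : ∀ j, star (v j) ⬝ᵥ v j = 1)
    (hdich : ∀ j, P *ᵥ v j = v j ∨ P *ᵥ v j = 0)
    (htr : ∀ X : Matrix m m ℂ, X.trace = ∑ j, star (v j) ⬝ᵥ (X *ᵥ v j)) {t : ℝ}
    (ht : t ≤ ((P.trace)⁻¹ * (P * A).trace).re) :
    ∃ j, P *ᵥ v j = v j ∧ t ≤ (star (v j) ⬝ᵥ (A *ᵥ v j)).re := by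
  classical
  set J : Finset ι := Finset.univ.filter fun j => P *ᵥ v j = v j with hJdef
  have hzero : ∀ j, ¬ P *ᵥ v j = v j → P *ᵥ v j = 0 := fun j hj => (hdich j).resolve_left hj
  -- `tr P = #J`
  have htrP : P.trace = (J.card : ℂ) := by
    rw [htr P, hJdef, Finset.natCast_card_filter]
    refine Finset.sum_congr rfl fun j _ => ?_
    by_cases h : P *ᵥ v j = v j
    · rw [if_pos h, h, hv1]
    · rw [if_neg h, hzero j h, dotProduct_zero]
  -- `tr (P A) = Σ_{j ∈ J} ⟨v_j, A v_j⟩`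
  have htrPA : (P * A).trace = ∑ j ∈ J, star (v j) ⬝ᵥ (A *ᵥ v j) := by
    rw [htr (P * A), hJdef, Finset.sum_filter]
    refine Finset.sum_congr rfl fun j _ => ?_
    rw [← mulVec_mulVec, ← ggv_adj hPh]
    by_cases h : P *ᵥ v j = v j
    · rw [if_pos h, h]
    · rw [if_neg h, hzero j h, star_zero, zero_dotProduct]
  -- `J` is nonempty
  have hJpos : 0 < J.card := by
    refine Nat.pos_of_ne_zero fun h => hP0 ?_
    rw [htrP, h, Nat.cast_zero]
  have hc : (0 : ℝ) < J.card := Nat.cast_pos.2 hJpos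
  -- the average
  have havg : ((P.trace)⁻¹ * (P * A).trace).re =
      (J.card : ℝ)⁻¹ * ∑ j ∈ J, (star (v j) ⬝ᵥ (A *ᵥ v j)).re := by
    rw [htrP, htrPA, ← Complex.re_sum, ← Complex.ofReal_natCast, ← Complex.ofReal_inv,
      Complex.re_ofReal_mul]
  rw [havg] at ht
  have hsum : ∑ _j ∈ J, t ≤ ∑ j ∈ J, (star (v j) ⬝ᵥ (A *ᵥ v j)).re := by
    rw [Finset.sum_const, nsmul_eq_mul]
    calc (J.card : ℝ) * t
        ≤ J.card * ((J.card : ℝ)⁻¹ * ∑ j ∈ J, (star (v j) ⬝ᵥ (A *ᵥ v j)).re) :=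
          mul_le_mul_of_nonneg_left ht hc.le
      _ = ∑ j ∈ J, (star (v j) ⬝ᵥ (A *ᵥ v j)).re := by
          rw [← mul_assoc, mul_inv_cancel₀ hc.ne', one_mul]
  obtain ⟨j, hjJ, hj⟩ := Finset.exists_le_of_sum_le (Finset.card_pos.1 hJpos) hsum
  exact ⟨j, (Finset.mem_filter.1 hjJ).2, hj⟩

/-! ### The stub -/

/-- **(E) A good ground vector.** For commuting Hermitian `K, N` and any `A` with `t ≤ Re ω_K(A)`
(tracial ground-state functional of `K`), there is a unit joint eigenvector `Φ` of `K` (to the ground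
energy) and of `N` with `t ≤ Re ⟨Φ, A Φ⟩`: with `P = K.groundProj` and `B = N - E₀(N) + 1`, the
orthonormal eigenbasis of `P B P` consists of vectors fixed or killed by `P` (`ggv_dichotomy`), the fixed
ones are ground vectors of `K` and eigenvectors of `B` (hence of `N`), and `Re ω_K(A)` is the average of
`Re ⟨v_j, A v_j⟩` over them (`ggv_exists_good_index`). Koma–Tasaki, J. Stat. Phys. 76 (1994) 745, proof
of Thm 2.2. (The positivity hypothesis on `A` is not used.) -/
theorem stub_goodGroundVector : GoodGroundVector := by
  intro n _ _ _ K N A hK hN hKN _ t ht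
  -- opaque abbreviations `P = K.groundProj`, `B = N - E₀(N) + 1`
  obtain ⟨P, hPdef⟩ : ∃ P : Matrix n n ℂ, P = K.groundProj := ⟨_, rfl⟩
  obtain ⟨B, hBdef⟩ : ∃ B : Matrix n n ℂ,
      B = N - algebraMap ℝ (Matrix n n ℂ) N.groundEnergy + 1 := ⟨_, rfl⟩
  have hPh : P.IsHermitian := by rw [hPdef]; exact groundProj_isHermitian K
  have hPP : P * P = P := by rw [hPdef]; exact groundProj_mul_self K
  have hPN : P * N = N * P := by rw [hPdef]; exact groundProj_commute_of_commute hK hKN.symm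
  have hP0 : P.trace ≠ 0 := by rw [hPdef]; exact trace_groundProj_ne_zero hK
  have hDpsd : (B - 1).PosSemidef := by
    rw [hBdef, add_sub_cancel_right]; exact posSemidef_sub_groundEnergy hN
  have hBh : B.IsHermitian := by
    have h := hDpsd.isHermitian.add isHermitian_one
    rwa [sub_add_cancel] at h
  have hMh : (P * B * P).IsHermitian := by
    have h := isHermitian_conjTranspose_mul_mul P hBh
    rwa [hPh.eq] at h
  have hPB : P * B = B * P := by
    rw [hBdef, mul_add, add_mul, mul_sub, sub_mul, mul_one, one_mul, hPN, Algebra.commutes]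
  have hB1 : ∀ w : n → ℂ, 0 ≤ star w ⬝ᵥ ((B - 1) *ᵥ w) := hDpsd.dotProduct_mulVec_nonneg
  -- the eigenfamily of `M = P B P`, its dichotomy, and a good index
  obtain ⟨v, hv1, hMv, htr⟩ := ggv_exists_eigenfamily hMh
  have hdich : ∀ j, P *ᵥ v j = v j ∨ P *ᵥ v j = 0 := fun j => by
    obtain ⟨c, hc⟩ := hMv j
    exact ggv_dichotomy hPh hPP hB1 hc
  have ht' : t ≤ ((P.trace)⁻¹ * (P * A).trace).re := by
    rwa [groundStateFunctional_apply, ← hPdef] at ht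
  obtain ⟨j, hPv, hj⟩ := ggv_exists_good_index (A := A) hPh hP0 hv1 hdich htr ht'
  obtain ⟨c, hc⟩ := hMv j
  -- `B v_j = c v_j` since `P v_j = v_j` and `P B = B P`
  have hBv : B *ᵥ v j = c • v j := by
    rw [← hc, ← mulVec_mulVec, ← mulVec_mulVec, hPv, mulVec_mulVec, hPB, ← mulVec_mulVec, hPv]
  refine ⟨v j, c - 1 + (N.groundEnergy : ℂ), hv1 j, ?_, ?_, hj⟩
  · -- `v_j = P v_j` is a ground vector of `K`
    rw [← mem_groundSpace_iff, ← hPv, hPdef]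
    exact groundProj_mulVec_mem K (v j)
  · -- `N = B - 1 + E₀(N)`
    have hNeq : N = B - 1 + algebraMap ℝ (Matrix n n ℂ) N.groundEnergy := by
      rw [hBdef]; abel
    have halg : algebraMap ℝ (Matrix n n ℂ) N.groundEnergy *ᵥ v j =
        (N.groundEnergy : ℂ) • v j := by
      rw [Algebra.algebraMap_eq_smul_one, smul_mulVec, one_mulVec,
        RCLike.real_smul_eq_coe_smul (K := ℂ)]
      rfl
    calc N *ᵥ v j = (B - 1 + algebraMap ℝ (Matrix n n ℂ) N.groundEnergy) *ᵥ v j := by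
          rw [← hNeq]
      _ = c • v j - v j + (N.groundEnergy : ℂ) • v j := by
          rw [add_mulVec, sub_mulVec, one_mulVec, hBv, halg]
      _ = (c - 1 + (N.groundEnergy : ℂ)) • v j := by module

end Summit.HubbardSuperconductivity.HubbardSuperconductivity.Theorems.NodalReduction

end
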